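import Summits.CriticalPhenomena.CardyFormulaZ2.Theorems.CardyComplexConeEdgePrecompactUFRSHalfPlaneArms
import Summits.CriticalPhenomena.CardyFormulaZ2.Theorems.CardyComplexConeEdgePrecompactUFRSRectBoundaryStrandDecayCases

/-!
# The flat three-strand decay HT from its two halves: genuine half-plane arms, and their decay
(line `qkz-strip-boundary-arm` of crux `CardyComplexCone.EdgePrecompact`, stmt-CriticalPhenomena-11387;
registered bridge `ufrs_rect_flatThreeStrandDecay` (HT) of the UFRS programme on rectangles,
hypothesis HT of `ufrs_markedPointDecay_rect_of_bridges`; worker of lead c5)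

## The statement HT

For an axis-parallel rectangle `D`, a point `z ∈ D` within `s` of `∂D` (`η ≤ s`), an admissible
fine-mesh datum `E` of `D`, a small shift `w` (`‖E.δ w‖ < η`) and all marked (`A`–`B`) edges of `E`
and of `shiftData E w` at distance `≥ 2S` from `z`:
`P_{1/2}(ufrsStrands E w z 3 s S) ≤ C (s/S)^{1+α}` with `C, α` depending on `D` only.

## Plan of the proof (decomposition registered on the item; this file lands the assembly)

* **HT-A `ufrs_rect_strandsHpArms` (deterministic, OPEN).** In the scale window
  `K₀ s ≤ S ≤ c₀` (`c₀ ≍` a quarter of the shorter side, so that `B(z, S)` sees one side or one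
  convex corner of `D`, of ONE boundary type since no marked edge is within `2S`), every
  configuration with three corner-disjoint strand-crossings of `A(z; s, S)` has, in one of
  `N₀` lattice frames `φ` (the frames of the nearby side for `E` and for `shiftData E w`), three
  LOOSE GENUINE ARMS of `ω`: `ω ∈ φ⋆ ⁻¹' hpLooseArms j 3 m R` with `m E.δ ≤ K₀ s`,
  `S ≤ K₀ R E.δ` (`…UFRSHalfPlaneArms.lean`). Mathematics: the sector decomposition of
  `ufrs_strands_zdDomArms` run in the full annulus — the exterior sector contains the boundary
  rows of both completed configurations (their polylines stay in the closed face domain), so arms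
  in interior sectors use no wired (`A`–`A`) and no `B`-touching edge and ARE arms of `ω`
  (`mem_bcBondConfig_cases`, `collarAgreement`); at a wired side the exterior sector is used only
  through DUAL arms, at a free side only through OPEN arms (both genuine); the case analysis on
  the colours of the middle strand gives three arms with same-colour arms in distinct sectors.
  Strands of the two different completions (tags `τ`) differ only inside the strip between the
  two parallel sides, where the smaller domain's wired/free row produces the only fake edges;
  this mixed case is the delicate part (difficulty (2) of the brief).
* **HT-B `hpLooseArms_three_decay` (probabilistic, OPEN).** The UNDOCKED half-plane three-arm
  bound `P_{1/2}(hpLooseArms j 3 m R) ≤ C (m/n)^{1+α}` for `1 ≤ m ≤ n`, `K n ≤ R`: LSW02 App. A in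
  the "`C_r` to `C_R`" form. The tree has the DOCKED form `Z2HalfPlane.real_threeArm_le` (open arm
  docked by an open leg, dual arms from the moat; ported to frames as `real_relabel_threeArm_le`);
  the missing input is the extension of undocked arms to the boundary (Kesten's arm separation in
  the half-plane, Nolin 2008 §4; or directly an undocked version of Werner's cluster-counting for
  the two-arm bound followed by Reimer's inequality and the RSW one-arm bound as in
  `Z2HalfPlane.real_threeArm_le`).
* **Assembly `ufrs_rect_flatThreeStrandDecay_of_hpArms` (this file, PROVED): HT-A → HT-B → HT.**
  Frame invariance of `P_{1/2}` (`real_preimage_relabel_hpLooseArms`) and a union bound over the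
  `N₀` frames give `P ≤ N₀ C (2 K K₀² s/S)^{1+α}` in the window `2 K K₀² Λ s ≤ S ≤ L`, after
  shrinking the outer radius to `min S c₀` (`ufrsStrands_mono_radii`; `Λ = max 1 (L/c₀)`,
  `L = width + height + 1`); for `S ≤ 2 K K₀² Λ s` the bound is trivial (`P ≤ 1`), and for
  `S > L` the event is EMPTY: the far end of a strand is a corner of an inner face of `E` or of
  `shiftData E w`, hence a point of `D` or of `D + E.δ w`,
  at distance `< L` from `z ∈ D` (`ufrsStrands_rect_eq_empty`,
  `…UFRSRectBoundaryStrandDecayCases.lean`).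

References: G. F. Lawler, O. Schramm, W. Werner, Electron. J. Probab. 7 (2002), App. A;
P. Nolin, Electron. J. Probab. 13 (2008), §4; S. Smirnov, C. R. Acad. Sci. Paris 333 (2001), §2;
M. Aizenman, A. Burchard, Duke Math. J. 99 (1999), App. A (sectors).
-/

namespace Summit.CriticalPhenomena.CardyFormulaZ2.Cruxes.EdgePrecompact.QkzStripBoundaryArm

open MeasureTheory Filter Set Metric
open scoped Topology BigOperators Pointwise
open Literature.Probability.LatticeModels Literature.Probability.Percolation
open Literature.Probability.RandomPlanarGeometry (DobrushinDomain)
open Summit.CriticalPhenomena.CardyFormulaZ2.Theses.CardyComplexCone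

noncomputable section

/-! ## Scale arithmetic -/

/-- Integer division by `K ≥ 1` loses at most a factor two once `R ≥ 2K`: `R / (2K) ≤ ⌊R/K⌋`. -/
theorem div_two_le_natDiv_HT {K R : ℕ} (hK : 1 ≤ K) (hR : 2 * K ≤ R) :
    (R : ℝ) / (2 * K) ≤ ((R / K : ℕ) : ℝ) := by
  have hK0 : (0 : ℝ) < K := by exact_mod_cast hK
  have h1 : ((R / K : ℕ) : ℝ) * K > R - K := by
    have := Nat.lt_div_mul_add (a := R) (b := K) (by omega)
    have h' : (R : ℝ) < (R / K : ℕ) * K + K := by exact_mod_cast this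
    linarith
  have hR' : (2 : ℝ) * K ≤ R := by exact_mod_cast hR
  rw [div_le_iff₀ (by positivity)]
  nlinarith

/-! ## The assembly -/

/-- **HT from its two halves** (registered conditional form of the bridge
`ufrs_rect_flatThreeStrandDecay`): the deterministic extraction of three loose genuine
half-plane arms of `ω` from three strand-crossings at a flat side / convex corner of a rectangle
(registered sub-goal `ufrs_rect_strandsHpArms`, first hypothesis) and the undocked half-plane
three-arm bound (registered sub-goal `hpLooseArms_three_decay`, second hypothesis) imply the
flat three-strand decay HT verbatim. See the module docstring for the bookkeeping (union over
the frames, frame invariance, trivial small-ratio regime, emptiness beyond the diameter). -/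
theorem ufrs_rect_flatThreeStrandDecay_of_hpArms : (∀ (D : DobrushinDomain), (∃ x₀ x₁ y₀ y₁ : ℝ, x₀ < x₁ ∧ y₀ < y₁ ∧ D.carrier = Set.Ioo x₀ x₁ ×ℂ Set.Ioo y₀ y₁) → ∃ (N₀ : ℕ) (K₀ c₀ : ℝ), 1 ≤ K₀ ∧ 0 < c₀ ∧ ∃ η₀ > (0:ℝ), ∀ η : ℝ, 0 < η → η < η₀ → ∃ δ₀ > (0:ℝ), ∀ E : DiscreteDobrushin, E.Ω = D.carrier → E.IsZdAdmissible → E.δ < δ₀ → ∀ w : Site 2, ‖meshPoint E.δ w‖ < η → ∀ (z : ℂ) (s S : ℝ), z ∈ D.carrier → infDist z D.carrierᶜ ≤ s → η ≤ s → K₀ * s ≤ S → S ≤ c₀ → (∀ e₀ : Sym2 (Site 2), (e₀ ∈ E.zdABEdges ∨ e₀ ∈ (shiftData E w).zdABEdges) → 2 * S ≤ dist (medialPoint E.δ e₀) z) → ∃ (φ : Fin N₀ → zdGraph 2 ≃g zdGraph 2) (j : Fin N₀ → ℤ) (m R : Fin N₀ → ℕ), (∀ i, 1 ≤ m i ∧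 (m i : ℝ) * E.δ ≤ K₀ * s ∧ S ≤ K₀ * R i * E.δ) ∧ ufrsStrands E w z 3 s S ⊆ ⋃ i, BondConfig.relabel (sym2Equiv (φ i).toEquiv) ⁻¹' hpLooseArms (j i) 3 (m i) (R i)) → (∃ C α : ℝ, 0 < C ∧ 0 < α ∧ ∃ K : ℕ, 1 ≤ K ∧ ∀ (j : ℤ) (m n R : ℕ), 1 ≤ m → m ≤ n → K * n ≤ R → (bondPercolation (zdGraph 2) half).real (hpLooseArms j 3 m R) ≤ C * ((m : ℝ) / n) ^ (1 + α)) → ∀ (D : DobrushinDomain), (∃ x₀ x₁ y₀ y₁ : ℝ, x₀ < x₁ ∧ y₀ < y₁ ∧ D.carrier = Set.Ioo x₀ x₁ ×ℂ Set.Ioo y₀ y₁) → ∃ C α : ℝ, 0 < C ∧ 0 < α ∧ ∃ η₀ > (0:ℝ), ∀ η : ℝ, 0 < η → η < η₀ → ∃ δ₀ > (0:ℝ), ∀ E : DiscreteDobrushin, E.Ω = D.carrier → E.IsZdAdmissible → E.δ < δ₀ → ∀ w : Site 2, ‖meshPoint E.δ w‖ < η → ∀ (z : ℂ) (s S : ℝ),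 z ∈ D.carrier → infDist z D.carrierᶜ ≤ s → η ≤ s → 0 < S → (∀ e₀ : Sym2 (Site 2), (e₀ ∈ E.zdABEdges ∨ e₀ ∈ (shiftData E w).zdABEdges) → 2 * S ≤ dist (medialPoint E.δ e₀) z) → (bondPercolation (zdGraph 2) half).real (ufrsStrands E w z 3 s S) ≤ C * (s / S) ^ (1 + α) := by
  intro hA hB D hD
  obtain ⟨x₀, x₁, y₀, y₁, hx, hy, hcar⟩ := hD
  obtain ⟨N₀, K₀, c₀, hK₀, hc₀, ηA, hηA, hAη⟩ := hA D ⟨x₀, x₁, y₀, y₁, hx, hy, hcar⟩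
  obtain ⟨C, α, hC, hα, K, hK, hBd⟩ := hB
  -- constants
  set L : ℝ := (x₁ - x₀) + (y₁ - y₀) + 1 with hL
  have hL1 : 1 ≤ L := by rw [hL]; linarith
  set Λ : ℝ := max 1 (L / c₀) with hΛ
  have hΛ1 : 1 ≤ Λ := le_max_left _ _
  have hΛpos : 0 < Λ := lt_of_lt_of_le one_pos hΛ1
  have hLΛ : L ≤ Λ * c₀ := by
    have : L / c₀ ≤ Λ := le_max_right _ _
    rwa [div_le_iff₀ hc₀] at this
  have hKr : (1 : ℝ) ≤ K := by exact_mod_cast hK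
  set K₁ : ℝ := 2 * K * K₀ ^ 2 with hK₁
  have hK₀sq : K₀ ≤ K₀ ^ 2 := by
    have h := mul_nonneg (by linarith : (0:ℝ) ≤ K₀) (by linarith : (0:ℝ) ≤ K₀ - 1)
    have h' : K₀ * (K₀ - 1) = K₀ ^ 2 - K₀ := by ring
    linarith
  have hK₀K₁ : K₀ ≤ K₁ := by
    have h : K₀ ^ 2 ≤ K * K₀ ^ 2 := le_mul_of_one_le_left (by positivity) hKr
    rw [hK₁]; nlinarith
  have hK₁1 : 1 ≤ K₁ := hK₀.trans hK₀K₁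
  set M : ℝ := K₁ * Λ with hM
  have hM1 : 1 ≤ M := by
    rw [hM]; exact one_le_mul_of_one_le_of_one_le hK₁1 hΛ1
  set Cf : ℝ := (1 + N₀ * C) * M ^ (1 + α) with hCf
  have hMpow : 1 ≤ M ^ (1 + α) := Real.one_le_rpow hM1 (by linarith)
  have hNC : (0 : ℝ) ≤ N₀ * C := mul_nonneg (Nat.cast_nonneg N₀) hC.le
  have hCf1 : M ^ (1 + α) ≤ Cf := by
    rw [hCf]; exact le_mul_of_one_le_left (by linarith) (by linarith)
  refine ⟨Cf, α, by positivity, hα, min ηA (1 / 2), lt_min hηA (by norm_num), fun η hη hηlt => ?_⟩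
  obtain ⟨δ₀, hδ₀, hAδ⟩ := hAη η hη (lt_of_lt_of_le hηlt (min_le_left _ _))
  refine ⟨δ₀, hδ₀, fun E hEΩ hadm hδ w hw z s S hz hzs hηs hS hmarked => ?_⟩
  set μ := bondPercolation (zdGraph 2) half with hμ
  have hs : 0 < s := lt_of_lt_of_le hη hηs
  have hδpos : 0 < E.δ := hadm.delta_pos
  have hzD : z ∈ Set.Ioo x₀ x₁ ×ℂ Set.Ioo y₀ y₁ := hcar ▸ hz
  -- the trivial regime `S ≤ M s`
  rcases le_or_gt S (M * s) with hsmall | hbig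
  · have hratio : 1 ≤ M * (s / S) := by
      rw [mul_div_assoc', le_div_iff₀ hS, one_mul]; exact hsmall
    calc μ.real (ufrsStrands E w z 3 s S) ≤ 1 := measureReal_le_one
      _ ≤ (M * (s / S)) ^ (1 + α) := Real.one_le_rpow hratio (by linarith)
      _ = M ^ (1 + α) * (s / S) ^ (1 + α) := Real.mul_rpow (by linarith) (by positivity)
      _ ≤ Cf * (s / S) ^ (1 + α) := mul_le_mul_of_nonneg_right hCf1 (by positivity)
  -- the empty regime `S > L`
  rcases lt_or_ge L S with hfar | hSL
  · have hw1 : ‖meshPoint E.δ w‖ < 1 := by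
      have := lt_of_lt_of_le hηlt (min_le_right _ _); linarith
    rw [ufrsStrands_rect_eq_empty (hEΩ.trans hcar) hw1 (subset_closure hzD) (by norm_num) (by rw [hL] at hfar; exact hfar.le),
      measureReal_empty]
    positivity
  -- the main regime: shrink the outer radius to `S' = min S c₀`
  set S' : ℝ := min S c₀ with hS'
  have hS'S : S' ≤ S := min_le_left _ _
  have hS'c : S' ≤ c₀ := min_le_right _ _
  have hS'pos : 0 < S' := lt_min hS hc₀
  have hSΛ : S ≤ Λ * S' := by
    rcases le_total S c₀ with h | h
    · rw [hS', min_eq_left h]; exact le_mul_of_one_le_left hS.le hΛ1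
    · rw [hS', min_eq_right h]; linarith
  have hK₁s : K₁ * s ≤ S' := by
    have h : Λ * (K₁ * s) < Λ * S' :=
      calc Λ * (K₁ * s) = M * s := by rw [hM]; ring
        _ < S := hbig
        _ ≤ Λ * S' := hSΛ
    exact (lt_of_mul_lt_mul_left h hΛpos.le).le
  have hK₀s : K₀ * s ≤ S' := (mul_le_mul_of_nonneg_right hK₀K₁ hs.le).trans hK₁s
  have hmarked' : ∀ e₀ : Sym2 (Site 2), (e₀ ∈ E.zdABEdges ∨ e₀ ∈ (shiftData E w).zdABEdges) →
      2 * S' ≤ dist (medialPoint E.δ e₀) z := fun e₀ he₀ => by linarith [hmarked e₀ he₀]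
  obtain ⟨φ, jj, m, R, hscale, hsub⟩ := hAδ E hEΩ hadm hδ w hw z s S' hz hzs hηs hK₀s hS'c hmarked'
  -- each frame term
  have hterm : ∀ i, μ.real (BondConfig.relabel (sym2Equiv (φ i).toEquiv) ⁻¹' hpLooseArms (jj i) 3 (m i) (R i)) ≤
      C * (K₁ * (s / S')) ^ (1 + α) := by
    intro i
    obtain ⟨hm1, hms, hSR⟩ := hscale i
    rw [hμ, real_preimage_relabel_hpLooseArms]
    have hm0 : (0 : ℝ) < m i := by exact_mod_cast hm1
    -- `R ≥ 2 K m`: `(2 K m)(δ K₀) = (2 K m δ) K₀ ≤ 2 K K₀² s = K₁ s ≤ S' ≤ K₀ R δ`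
    have hRreal : 2 * K * (m i : ℝ) ≤ R i := by
      have h1 : 2 * K * (m i : ℝ) * E.δ ≤ 2 * K * (K₀ * s) := by
        rw [show 2 * K * (m i : ℝ) * E.δ = 2 * K * ((m i : ℝ) * E.δ) by ring]
        exact mul_le_mul_of_nonneg_left hms (by positivity)
      have h4 : (2 * K * (m i : ℝ)) * (E.δ * K₀) ≤ (R i : ℝ) * (E.δ * K₀) :=
        calc (2 * K * (m i : ℝ)) * (E.δ * K₀) = (2 * K * (m i : ℝ) * E.δ) * K₀ := by ring
          _ ≤ (2 * K * (K₀ * s)) * K₀ := mul_le_mul_of_nonneg_right h1 (by linarith)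
          _ = K₁ * s := by rw [hK₁]; ring
          _ ≤ K₀ * R i * E.δ := hK₁s.trans hSR
          _ = (R i : ℝ) * (E.δ * K₀) := by ring
      exact le_of_mul_le_mul_right h4 (by positivity)
    have hRnat : 2 * K * m i ≤ R i := by exact_mod_cast hRreal
    set n : ℕ := R i / K with hn
    have hmn : m i ≤ n := by
      rw [hn, Nat.le_div_iff_mul_le (by omega)]
      calc m i * K = K * m i := mul_comm _ _
        _ ≤ 2 * (K * m i) := Nat.le_mul_of_pos_left _ (by norm_num)
        _ = 2 * K * m i := (mul_assoc _ _ _).symm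
        _ ≤ R i := hRnat
    have hKn : K * n ≤ R i := Nat.mul_div_le (R i) K
    have hn0 : (0 : ℝ) < n := by
      have : 1 ≤ n := hm1.trans hmn
      exact_mod_cast this
    refine (hBd (jj i) (m i) n (R i) hm1 hmn hKn).trans ?_
    refine mul_le_mul_of_nonneg_left (Real.rpow_le_rpow (by positivity) ?_ (by linarith)) hC.le
    -- `m / n ≤ K₁ s / S'`
    have h2K : 2 * K ≤ R i := by
      have : 2 * K * 1 ≤ 2 * K * m i := Nat.mul_le_mul_left _ hm1
      omega
    have hndiv : (R i : ℝ) / (2 * K) ≤ n := div_two_le_natDiv_HT hK h2K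
    have h1 : (R i : ℝ) ≤ 2 * K * n := by
      rw [div_le_iff₀ (by positivity)] at hndiv; linarith
    have h2 : (m i : ℝ) * S' ≤ K₀ * s * (K₀ * R i) :=
      calc (m i : ℝ) * S' ≤ (m i : ℝ) * (K₀ * R i * E.δ) := mul_le_mul_of_nonneg_left hSR (by positivity)
        _ = ((m i : ℝ) * E.δ) * (K₀ * R i) := by ring
        _ ≤ (K₀ * s) * (K₀ * R i) := mul_le_mul_of_nonneg_right hms (by positivity)
    rw [div_le_iff₀ hn0,
      show K₁ * (s / S') * n = (2 * K * K₀ ^ 2 * s * n) / S' by rw [hK₁]; ring, le_div_iff₀ hS'pos]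
    calc (m i : ℝ) * S' ≤ K₀ * s * (K₀ * R i) := h2
      _ ≤ K₀ * s * (K₀ * (2 * K * n)) := by gcongr
      _ = 2 * K * K₀ ^ 2 * s * n := by ring
  -- union bound and conclusion
  have hmono : ufrsStrands E w z 3 s S ⊆ ufrsStrands E w z 3 s S' := ufrsStrands_mono_radii le_rfl hS'S
  have hratio : K₁ * (s / S') ≤ M * (s / S) := by
    rw [hM, mul_div_assoc', mul_div_assoc', div_le_div_iff₀ hS'pos hS]
    calc K₁ * s * S ≤ K₁ * s * (Λ * S') := mul_le_mul_of_nonneg_left hSΛ (by positivity)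
      _ = K₁ * Λ * s * S' := by ring
  calc μ.real (ufrsStrands E w z 3 s S) ≤ μ.real (ufrsStrands E w z 3 s S') := measureReal_mono hmono (measure_ne_top _ _)
    _ ≤ μ.real (⋃ i, BondConfig.relabel (sym2Equiv (φ i).toEquiv) ⁻¹' hpLooseArms (jj i) 3 (m i) (R i)) :=
        measureReal_mono hsub (measure_ne_top _ _)
    _ ≤ ∑ i, μ.real (BondConfig.relabel (sym2Equiv (φ i).toEquiv) ⁻¹' hpLooseArms (jj i) 3 (m i) (R i)) :=
        measureReal_iUnion_fintype_le _
    _ ≤ ∑ _i : Fin N₀, C * (K₁ * (s / S')) ^ (1 + α) := Finset.sum_le_sum fun i _ => hterm i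
    _ = N₀ * C * (K₁ * (s / S')) ^ (1 + α) := by
        rw [Finset.sum_const, Finset.card_univ, Fintype.card_fin, nsmul_eq_mul]; ring
    _ ≤ N₀ * C * (M * (s / S)) ^ (1 + α) :=
        mul_le_mul_of_nonneg_left (Real.rpow_le_rpow (by positivity) hratio (by linarith)) hNC
    _ = N₀ * C * M ^ (1 + α) * (s / S) ^ (1 + α) := by
        rw [Real.mul_rpow (by linarith) (by positivity)]; ring
    _ ≤ Cf * (s / S) ^ (1 + α) := by
        refine mul_le_mul_of_nonneg_right ?_ (by positivity)
        rw [hCf, add_mul, one_mul]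
        have : 0 ≤ M ^ (1 + α) := by positivity
        linarith

end

end Summit.CriticalPhenomena.CardyFormulaZ2.Cruxes.EdgePrecompact.QkzStripBoundaryArm
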